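import Summits.QuantumAdvantage.QuantumAdvantage.Theorems.MobiusLadderLiouvilleNotPPolyOneTimePadDefs
import Summits.QuantumAdvantage.QuantumAdvantage.Theorems.MobiusLadderLiouvilleNotTC0
import Literature.Computability.Complexity.CircuitClassesProofs
import HarnessLib

/-!
# Crux `MobiusLadder.LiouvilleNotPPoly` (stmt-QuantumAdvantage-1389), line `SketchIdeator4`, stub `stub_mildAvgHard_of_apex`

The link of the line's ladder: the apex `C⁺ = LiouvilleOrthogonalPPoly` (every polynomial-size
`B₂`-circuit has correlation `o(2^n)` with `λ` below `2^n`) sits above the `1/poly` level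
`MildAvgHard 1` (every polynomial-size `B₂`-circuit errs on at least `2^{n-1}/n` of the instances
`N ∈ [2^{n-1}, 2^n)`).

Proof (the flip trick). Given a `B₂`-circuit `C` on `n = k+1` bits of size `≤ p(n)`, one extra `B₂`
gate gives the circuit `C'` with `C'(x) = C(x)` if the top bit `x_k` is `1` and `C'(x) = ¬C(x)`
otherwise (`exists_flip_circuit`, by the tree's straight-line calculus `CktSize`). In
`corr n C + corr n C'` the lower halves `N < 2^k` cancel and the upper halves agree, so the sum is
`2·S` with `S = ∑_{2^k ≤ N < 2^{k+1}} λ(N)·sgn C(bits N) = #agree − #disagree = 2^k − 2·disagree n C`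
(`sum_Ico_eq`). The apex at `ε = 1/8` for the size polynomial `p + 1` gives `|S| ≤ 2^k/4`, whence
`disagree n C ≥ (3/8)·2^k` and `n · disagree n C ≥ 2^k` as soon as `n ≥ 3`.

Sources: folklore (correlation versus agreement count); S. Arora, B. Barak, *Computational
Complexity* (2009), Def. 6.1 (circuits, size) for the conventions of the tree's `Circuit`.
-/

set_option linter.dupNamespace false -- D-0017: single-problem summit ⇒ `QuantumAdvantage.QuantumAdvantage` by design

noncomputable section

namespace Summit.QuantumAdvantage.QuantumAdvantage.Theorems.LiouvilleNotPPoly.OneTimePad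

open Literature.Computability.Complexity
open Literature.Probability.RandomGraphs.LowDegree (sgn sgn_true sgn_false)
open _root_.Computability Filter Finset Polynomial
open Summit.QuantumAdvantage.QuantumAdvantage.Theorems.MobiusLadder
open Summit.QuantumAdvantage.QuantumAdvantage.Theorems.LiouvilleOrthogonalTC0 (bits ofBits lamBit)

namespace MildAvgHardOfApex

/-- **The flip gadget.** For a `B₂`-circuit `C` and an input position `i`, one extra `B₂` gate
(the binary gate `(a, b) ↦ if b then a else ¬a`, fed by the output of `C` and the input `x_i`)
gives a `B₂`-circuit computing `C(x)` when `x_i = 1` and `¬C(x)` when `x_i = 0`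
(Arora–Barak 2009, Def. 6.1; the tree's `CktSize` calculus). [folklore] -/
theorem exists_flip_circuit {n : ℕ} (C : Circuit (Fin n)) (hC : C.IsOver B2) (i : Fin n) :
    ∃ C' : Circuit (Fin n), C'.IsOver B2 ∧ C'.size ≤ C.size + 1 ∧
      ∀ x, C'.eval x = (if x i then C.eval x else !C.eval x) := by
  have h1 : CktSize B2 (fun x => Sum.elim (fun (_ : Unit) => C.eval x) (fun (_ : Unit) => x i))
      (C.size + 0) :=
    (C.cktSize_eval hC).pair (CktSize.proj B2 fun _ : Unit => i)
  have h2 : CktSize B2 (fun (y : Unit ⊕ Unit → Bool) (_ : Unit) =>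
      (⟨2, fun v => if v 1 then v 0 else !v 0⟩ : GateFn).2
        fun a => y ((![Sum.inl (), Sum.inr ()] : Fin 2 → Unit ⊕ Unit) a)) 1 :=
    CktSize.gate (B := B2) (⟨2, fun v => if v 1 then v 0 else !v 0⟩ : GateFn) (by simp [B2])
      ![Sum.inl (), Sum.inr ()]
  have h3 : CktSize B2 (fun (x : Fin n → Bool) (_ : Unit) => if x i then C.eval x else !C.eval x)
      (C.size + 0 + 1) :=
    (h1.comp h2).congr fun x _ => by simp
  obtain ⟨C', hC', hsize, heval⟩ := h3.toCircuit
  exact ⟨C', hC', by omega, heval⟩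

/-- Splitting a sum over `[0, 2^(k+1))` into the halves `[0, 2^k)` and `[2^k, 2^(k+1))`. [folklore] -/
theorem sum_range_two_pow_succ (f : ℕ → ℝ) (k : ℕ) :
    ∑ N ∈ Finset.range (2 ^ (k + 1)), f N =
      ∑ N ∈ Finset.range (2 ^ k), f N + ∑ N ∈ Finset.Ico (2 ^ k) (2 ^ (k + 1)), f N :=
  (Finset.sum_range_add_sum_Ico f (Nat.pow_le_pow_right Nat.two_pos (Nat.le_succ k))).symm

/-- **The flip trick.** If `C'` computes `C` on inputs with top bit `1` and `¬C` on inputs with top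
bit `0`, then in `corr (k+1) C + corr (k+1) C'` the lower halves cancel (`sgn (¬b) = -sgn b`) and the
upper halves agree: the sum is twice the correlation on the instances `N ∈ [2^k, 2^(k+1))`. [folklore] -/
theorem corr_add_corr_flip {k : ℕ} (C C' : Circuit (Fin (k + 1)))
    (heval : ∀ x, C'.eval x = (if x (Fin.last k) then C.eval x else !C.eval x)) :
    corr (k + 1) C + corr (k + 1) C' =
      2 * ∑ N ∈ Finset.Ico (2 ^ k) (2 ^ (k + 1)),
        ((ArithmeticFunction.liouville N : ℤ) : ℝ) * sgn (C.eval (bits (k + 1) N)) := by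
  have hlow : ∑ N ∈ Finset.range (2 ^ k),
      ((ArithmeticFunction.liouville N : ℤ) : ℝ) * sgn (C'.eval (bits (k + 1) N)) =
        -∑ N ∈ Finset.range (2 ^ k),
          ((ArithmeticFunction.liouville N : ℤ) : ℝ) * sgn (C.eval (bits (k + 1) N)) := by
    rw [← Finset.sum_neg_distrib]
    refine Finset.sum_congr rfl fun N hN => ?_
    rw [Finset.mem_range] at hN
    have hbit : bits (k + 1) N (Fin.last k) = false := Nat.testBit_lt_two_pow hN
    rw [heval, hbit]
    rcases Bool.eq_false_or_eq_true (C.eval (bits (k + 1) N)) with h' | h' <;> simp [h']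
  have hhigh : ∑ N ∈ Finset.Ico (2 ^ k) (2 ^ (k + 1)),
      ((ArithmeticFunction.liouville N : ℤ) : ℝ) * sgn (C'.eval (bits (k + 1) N)) =
        ∑ N ∈ Finset.Ico (2 ^ k) (2 ^ (k + 1)),
          ((ArithmeticFunction.liouville N : ℤ) : ℝ) * sgn (C.eval (bits (k + 1) N)) := by
    refine Finset.sum_congr rfl fun N hN => ?_
    rw [Finset.mem_Ico] at hN
    have hbit : bits (k + 1) N (Fin.last k) = true := testBit_eq_true_of_two_pow_le hN.1 hN.2
    rw [heval, hbit]
    simp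
  unfold corr
  rw [sum_range_two_pow_succ, sum_range_two_pow_succ, hlow, hhigh]
  ring

/-- **Correlation on the instances = agreements − disagreements.** For `N ∈ [2^k, 2^(k+1))`
(so `N ≠ 0`, `λ(N) = ±1`) the term `λ(N)·sgn C(bits N)` is `+1` when the verdict `C(bits N)` equals
`lamBit N = [λ(N) = -1]` and `−1` otherwise, so the correlation on the `2^k` instances is
`2^k − 2·disagree (k+1) C`. [folklore] -/
theorem sum_Ico_eq {k : ℕ} (C : Circuit (Fin (k + 1))) :
    ∑ N ∈ Finset.Ico (2 ^ k) (2 ^ (k + 1)),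
        ((ArithmeticFunction.liouville N : ℤ) : ℝ) * sgn (C.eval (bits (k + 1) N)) =
      (2 : ℝ) ^ k - 2 * (disagree (k + 1) C : ℝ) := by
  have hterm : ∀ N ∈ Finset.Ico (2 ^ k) (2 ^ (k + 1)),
      ((ArithmeticFunction.liouville N : ℤ) : ℝ) * sgn (C.eval (bits (k + 1) N)) =
        1 - 2 * (if C.eval (bits (k + 1) N) ≠ lamBit N then 1 else 0) := by
    intro N hN
    rw [Finset.mem_Ico] at hN
    have hN0 : N ≠ 0 := by
      have := Nat.one_le_two_pow (n := k)
      omega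
    rcases liouville_eq_one_or_eq_neg_one hN0 with h | h
    · have hlam : lamBit N = false := by
        show decide (ArithmeticFunction.liouville N = -1) = false
        rw [h]
        decide
      rw [h, hlam]
      rcases Bool.eq_false_or_eq_true (C.eval (bits (k + 1) N)) with h' | h' <;> rw [h'] <;> norm_num
    · have hlam : lamBit N = true := by
        show decide (ArithmeticFunction.liouville N = -1) = true
        rw [h]
        decide
      rw [h, hlam]
      rcases Bool.eq_false_or_eq_true (C.eval (bits (k + 1) N)) with h' | h' <;> rw [h'] <;> norm_num
  have hcard : (Finset.Ico (2 ^ k) (2 ^ (k + 1))).card = 2 ^ k := by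
    rw [Nat.card_Ico, pow_succ]
    omega
  rw [Finset.sum_congr rfl hterm, Finset.sum_sub_distrib, Finset.sum_const, hcard, nsmul_eq_mul,
    mul_one, ← Finset.mul_sum, Finset.sum_boole]
  unfold disagree
  rw [Nat.add_sub_cancel]
  push_cast
  ring

end MildAvgHardOfApex

open MildAvgHardOfApex

/-- **Link of the ladder: the apex sits above the `1/poly` level, `C⁺ ⇒ MildAvgHard 1`.** From
correlation `≤ 2^n/8` for all `B₂`-circuits of size `≤ p(n) + 1` (the apex at `ε = 1/8`) get
`n · disagree n C ≥ 2^{n-1}` for every `B₂`-circuit `C` of size `≤ p(n)` and every `n ≥ 3`: apply the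
apex to `C` and to its flip `C'` (`exists_flip_circuit`); by `corr_add_corr_flip` and `sum_Ico_eq`,
`2·(2^{n-1} − 2·disagree n C) ≤ |corr n C| + |corr n C'| ≤ 2^n/4`, i.e. `disagree n C ≥ (3/8)·2^{n-1}`.
[folklore] -/
theorem stub_mildAvgHard_of_apex : LiouvilleOrthogonalPPoly → MildAvgHard 1 := by
  intro H p
  have hev := H (p + 1) (1 / 8) (by norm_num)
  filter_upwards [hev, Filter.eventually_ge_atTop 3] with n hn hn3 C hC hsize
  obtain ⟨k, rfl⟩ : ∃ k, n = k + 1 := ⟨n - 1, by omega⟩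
  have hsize' : C.size ≤ (p + 1).eval (k + 1) := by
    rw [eval_add, eval_one]
    omega
  obtain ⟨C', hC', hsizeC', hevalC'⟩ := exists_flip_circuit C hC (Fin.last k)
  have h1 : |corr (k + 1) C| ≤ 1 / 8 * (2 : ℝ) ^ (k + 1) := hn C hC hsize'
  have h2 : |corr (k + 1) C'| ≤ 1 / 8 * (2 : ℝ) ^ (k + 1) := hn C' hC' (by
    rw [eval_add, eval_one]
    omega)
  have hsum := corr_add_corr_flip C C' hevalC'
  rw [sum_Ico_eq] at hsum
  have habs : |corr (k + 1) C + corr (k + 1) C'| ≤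
      1 / 8 * (2 : ℝ) ^ (k + 1) + 1 / 8 * (2 : ℝ) ^ (k + 1) :=
    (abs_add_le _ _).trans (add_le_add h1 h2)
  rw [hsum] at habs
  have hle := (abs_le.1 habs).2
  rw [pow_succ] at hle
  have hk : (3 : ℝ) ≤ (k : ℝ) + 1 := by exact_mod_cast hn3
  have hd : (0 : ℝ) ≤ (disagree (k + 1) C : ℝ) := Nat.cast_nonneg _
  have h3d : 3 * (disagree (k + 1) C : ℝ) ≤ ((k : ℝ) + 1) * (disagree (k + 1) C : ℝ) :=
    mul_le_mul_of_nonneg_right hk hd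
  have hpos : (0 : ℝ) < (2 : ℝ) ^ k := by positivity
  rw [Nat.add_sub_cancel, pow_one]
  push_cast
  linarith

end Summit.QuantumAdvantage.QuantumAdvantage.Theorems.LiouvilleNotPPoly.OneTimePad

end
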